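import Mathlib.AlgebraicGeometry.EllipticCurve.Reduction
import Mathlib.AlgebraicGeometry.EllipticCurve.Affine.Point
import Mathlib.AlgebraicGeometry.EllipticCurve.VariableChange
import Mathlib.GroupTheory.Index
import Mathlib.NumberTheory.Padics.HeightOneSpectrum
import Mathlib.NumberTheory.Padics.RingHoms
import Mathlib.Algebra.BigOperators.Finprod
import Mathlib.NumberTheory.Padics.PadicIntegers
import Mathlib.RingTheory.AdicCompletion.Basic
import Literature.NumberTheory.DiophantineGeometry.LocalReduction
import HarnessLib

-- provenance: harness21/H21/H21/Prelude/TranscendEllArithS/Tamagawa.lean @ 93a4f70 (interim HEAD d8f2665); M5 mechanical rewrite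
/-!
# Tamagawa numbers of Weierstrass curves (trunk T-ELLARITH, G06 TranscendEllArithS, item C16)

Let `R` be a discrete valuation ring with fraction field `K` and let `W` be a Weierstrass curve
over `K`. For an `R`-minimal Weierstrass equation, the subgroup `E₀(K) ≤ E(K)` of points with
nonsingular reduction has finite index when `K` is a nonarchimedean local field, and the
*Tamagawa number* is `c(E/K) := [E(K) : E₀(K)]` (Silverman, *AEC*, VII.2.1, VII.6.1 and Ex. 7.6;
Tate, *Algorithm for determining the type of a singular fiber in an elliptic pencil*, Antwerp IV,
1975, §1; Wiles, *The Birch and Swinnerton-Dyer conjecture*, Clay Millennium text, §1).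
Bib key of the `cite` tags: [SilvermanAEC2009] (2nd ed., Ch. VII).

We follow the *index route* only: no Néron model, no Kodaira symbols, no Tate's algorithm.

## Main definitions (all in `namespace WeierstrassCurve`, as deliberate dot-notation extensions of
Mathlib's `WeierstrassCurve.reduction` / `WeierstrassCurve.localPolynomial` API)

* `WeierstrassCurve.IsNonsingularReductionPoint R W P`: the `K`-point `P` of the `R`-minimal
  equation `W` reduces to a nonsingular point of `W.reduction R`.
* `WeierstrassCurve.goodReductionSubgroup R W`: the subgroup `E₀(K)` generated by such points.
* `WeierstrassCurve.localTamagawaNumber R W`: `[E(K) : E₀(K)]` computed on the `R`-minimal model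
  `W.minimal R` (so it is defined for every `W`, model-independently, exactly like Mathlib's
  `WeierstrassCurve.localPolynomial`).
* `WeierstrassCurve.tamagawaProduct W`: for a number field `K`, `∏ᶠ v, c_v`, over the finite
  places `v : HeightOneSpectrum (𝓞 K)` (same pattern as Mathlib's `WeierstrassCurve.LFunction`).
* `WeierstrassCurve.localTamagawaNumber_baseChange_eq`: the local factor at a finite place `v` is,
  definitionally, the index computed on `W.localMinimalModel v` from the accepted H21 file
  `Literature.Prelude.DiophValNum.LocalReduction`.
* `WeierstrassCurve.HasGoodReductionAtPrime W p`,
  `WeierstrassCurve.HasMultiplicativeReductionAtPrime W p` (for `K = ℚ`, `p` a rational prime):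
  model-independent wrappers of Mathlib's classes `WeierstrassCurve.HasGoodReduction`,
  `WeierstrassCurve.HasMultiplicativeReduction` applied to the `ℤ_[p]`-minimal model of
  `W.baseChange ℚ_[p]` (the form consumed by `bsd.S30`).

## H21 declarations reused (not redefined here)

The place-indexed predicates `WeierstrassCurve.HasGoodReductionAt v W`,
`WeierstrassCurve.HasMultiplicativeReductionAt v W` (argument order `v W`, for `v : HeightOneSpectrum A`
over any Dedekind domain `A`), the chosen local minimal model `WeierstrassCurve.localMinimalModel v W`
and their model-independence lemmas (`hasGoodReductionAt_smul_iff`, ...) live in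
`Literature.Prelude.DiophValNum.LocalReduction`, which this file imports; dot notation
`W.HasGoodReductionAt v` works unchanged for `v : HeightOneSpectrum (𝓞 K)`. Since
`HasGoodReductionAt` there is a `def … : Prop` (not a class), a user of
`localTamagawaNumber_eq_one_of_hasGoodReduction` at a place `v` must `haveI` the instance
first; `localTamagawaNumber_eq_one_of_hasGoodReductionAt` packages this.

## Mathlib anchors used (grepped at the pin)

`WeierstrassCurve.IsMinimal`, `WeierstrassCurve.minimal`, `WeierstrassCurve.reduction`,
`WeierstrassCurve.HasGoodReduction`, `WeierstrassCurve.HasMultiplicativeReduction`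
(`AlgebraicGeometry/EllipticCurve/Reduction.lean`), `WeierstrassCurve.Affine.Point` and its
`AddCommGroup` instance, `AddSubgroup.index`, `IsDedekindDomain.HeightOneSpectrum.adicCompletion`,
`adicCompletionIntegers`, `Padic`, `PadicInt.isFractionRing`, `IsAdicComplete`.
Mathlib has no Tamagawa number, Néron model or component group; nothing here duplicates Mathlib.

## Design choices

* Group-wide rule (outline §0): `noncomputable section`, `open scoped Classical`, and no
  `[DecidableEq K]` variable, so that the `AddCommGroup W.toAffine.Point` instance is elaborated
  against the classical decidability instance uniformly across T-ELLARITH files.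
* `goodReductionSubgroup` is an `AddSubgroup.closure`; that the generating set is already a
  subgroup (Silverman VII.2.1) is the sorried lemma `mem_goodReductionSubgroup_iff`. This keeps the
  definition free of `sorry`.
* `AddSubgroup.index` has junk value `0` for subgroups of infinite index;
  `localTamagawaNumber_ne_zero` records finiteness for complete `R` with finite residue field.
* Completeness of `K` is phrased algebraically as `IsAdicComplete (IsLocalRing.maximalIdeal R) R`
  (Mathlib provides this instance for `ℤ_[p]`, `PadicIntegers.lean`). Mathlib does *not* register
  `Finite (IsLocalRing.ResidueField ℤ_[p])` as an instance, but it is one `Finite.of_equiv` away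
  from `PadicInt.residueField : IsLocalRing.ResidueField ℤ_[p] ≃+* ZMod p`; the specialisation
  `localTamagawaNumber_padic_ne_zero` performs this `haveI` (proved from the general lemma, no new
  instance is registered).
  At the pin Mathlib has no `IsAdicComplete` instance for `v.adicCompletionIntegers K`, so
  `localTamagawaNumber_ne_zero` cannot yet be instantiated at the factors of `tamagawaProduct`;
  the global finiteness facts `mulSupport_localTamagawaNumber_finite` and `tamagawaProduct_pos`
  are therefore stated independently.
* Model independence `localTamagawaNumber_variableChange` carries `[W.IsElliptic]`: for `Δ = 0`
  Mathlib's `IsMinimal` holds for *every* integral model, so `W.minimal R` is then an arbitrary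
  integral model and the index `[E_ns(K) : E₀]` genuinely depends on it (e.g. a non-split node
  versus a rescaled cuspidal model of the same singular cubic); compare the `_smul_iff` lemmas of
  `LocalReduction`.
* The prime-indexed predicates `HasGoodReductionAtPrime`, `HasMultiplicativeReductionAtPrime`
  (`ℚ_[p]` / `ℤ_[p]` route, consumed by `bsd.S30`) are related to the place-indexed
  `HasGoodReductionAt v`, `v : HeightOneSpectrum (𝓞 ℚ)`, through Mathlib's
  `Rat.HeightOneSpectrum.primesEquiv : HeightOneSpectrum (𝓞 ℚ) ≃ Nat.Primes` and
  `Rat.HeightOneSpectrum.adicCompletion.padicEquiv v : v.adicCompletion ℚ ≃A[ℚ] ℚ_[primesEquiv v]`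
  (`NumberTheory/Padics/HeightOneSpectrum.lean`) by the sorried bridge lemmas
  `hasGoodReductionAtPrime_primesEquiv_iff`, `hasMultiplicativeReductionAtPrime_primesEquiv_iff`
  and `localTamagawaNumber_padic_eq` (transport of minimal models along a valued-field
  isomorphism; routine but not in Mathlib).
-/

noncomputable section

open scoped Classical

namespace WeierstrassCurve

section Local

variable (R : Type*) [CommRing R] [IsDomain R] [IsDiscreteValuationRing R] {K : Type*}
  [Field K] [Algebra R K] [IsFractionRing R K] (W : WeierstrassCurve K)

/-- A `K`-rational point `P` of an `R`-minimal Weierstrass equation `W` *has nonsingular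
reduction* if its image under the reduction map `E(K) → Ẽ(k)` (Silverman, *AEC*, VII.2) is a
nonsingular point of the reduced curve `W.reduction R` over the residue field `k` of `R`.

Concretely: the point at infinity reduces to the (always nonsingular) point at infinity; an affine
point `(x, y)` with `x ∉ R` is non-integral and also reduces to the point at infinity (Silverman,
*AEC*, VII.2, proof of Prop. 2.1); and an affine point with `x ∈ R` automatically has `y ∈ R`
(because the minimal equation is integral and `R` is integrally closed, `y` being a root of a monic
quadratic over `R`), and it reduces to the affine point `(x̄, ȳ)`, which we require to be
nonsingular on `W.reduction R`. Hence the disjunction below is exhaustive. [folklore] -/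
def IsNonsingularReductionPoint [W.IsMinimal R] : W.toAffine.Point → Prop
  | .zero => True
  | .some x y _ =>
      x ∉ Set.range (algebraMap R K) ∨
        ∃ x₀ y₀ : R, algebraMap R K x₀ = x ∧ algebraMap R K y₀ = y ∧
          (W.reduction R).toAffine.Nonsingular (IsLocalRing.residue R x₀)
            (IsLocalRing.residue R y₀)

/-- The point at infinity has nonsingular reduction (by definition). [folklore] -/
@[simp]
theorem isNonsingularReductionPoint_zero [W.IsMinimal R] :
    W.IsNonsingularReductionPoint R (0 : W.toAffine.Point) :=
  trivial

/-- The subgroup `E₀(K) ≤ E(K)` of points of an `R`-minimal Weierstrass equation with nonsingular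
reduction (Silverman, *AEC*, VII.2, p. 188 and Prop. VII.2.1).

It is defined as the `AddSubgroup.closure` of the set of points with nonsingular reduction;
the closure is used only because the fact that this set is already a subgroup (Silverman, *AEC*,
Prop. VII.2.1: `E₀(K)` is a subgroup and reduction `E₀(K) → Ẽ_ns(k)` is a homomorphism) is the
sorried lemma
`WeierstrassCurve.mem_goodReductionSubgroup_iff`. This keeps the definition `sorry`-free. [folklore] -/
def goodReductionSubgroup [W.IsMinimal R] : AddSubgroup W.toAffine.Point :=
  AddSubgroup.closure {P | W.IsNonsingularReductionPoint R P}

/-- The set of points with nonsingular reduction of a minimal Weierstrass equation over the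
fraction field of a discrete valuation ring is a subgroup, so membership in
`goodReductionSubgroup` is just the predicate `IsNonsingularReductionPoint`
(Silverman, *AEC*, Prop. VII.2.1: the exact sequence `0 → E₁(K) → E₀(K) → Ẽ_ns(k) → 0`, in
particular `E₀(K)` is a subgroup). [cite: SilvermanAEC2009, Prop. VII.2.1] -/
def mem_goodReductionSubgroup_iff : Prop :=
  ∀ [W.IsMinimal R] (P : W.toAffine.Point),
    P ∈ W.goodReductionSubgroup R ↔ W.IsNonsingularReductionPoint R P

/-- The *local Tamagawa number* `c(W/K) := [E(K) : E₀(K)]` of a Weierstrass curve `W` over the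
fraction field `K` of a discrete valuation ring `R` (Silverman, *AEC*, VII.6.1 and Ex. 7.6; Tate,
Antwerp IV (1975), §1; Wiles, Clay BSD text, §1).

It is computed on the `R`-minimal model `W.minimal R` (Mathlib), so that the definition makes sense
for every Weierstrass equation over `K` and does not depend on the chosen equation
(`localTamagawaNumber_variableChange`); this is the same pattern as Mathlib's
`WeierstrassCurve.localPolynomial`. The value is `AddSubgroup.index`, whose junk value is `0` when
the index is infinite; see `localTamagawaNumber_ne_zero` for finiteness over local fields. [cite: IV1975] -/
def localTamagawaNumber : ℕ :=
  ((W.minimal R).goodReductionSubgroup R).index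

/-- Finiteness of `E(K)/E₀(K)` over a complete discretely valued field with finite residue field:
the local Tamagawa number of an elliptic curve is nonzero, i.e. `E₀(K)` has finite index in
`E(K)` (Silverman, *AEC*, Cor. VII.6.2 via Kodaira–Néron, Thm. VII.6.1; Tate, Antwerp IV (1975),
§1). For `R = ℤ_[p]` see `localTamagawaNumber_padic_ne_zero` (Mathlib has the `IsAdicComplete`
instance; finiteness of the residue field follows from `PadicInt.residueField`). Mathlib currently
has no `IsAdicComplete` instance for `v.adicCompletionIntegers K`, so this lemma does not yet
specialise to the factors of `tamagawaProduct` (see the module docstring). [cite: IV1975] -/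
def localTamagawaNumber_ne_zero : Prop :=
  ∀ [IsAdicComplete (IsLocalRing.maximalIdeal R) R] [Finite (IsLocalRing.ResidueField R)] [W.IsElliptic],
    W.localTamagawaNumber R ≠ 0

/-- If the `R`-minimal model of `W` has good reduction then every point has nonsingular
reduction, so `E₀(K) = E(K)` and the local Tamagawa number is `1`
(Silverman, *AEC*, VII.2, remark after Prop. 2.1; Tate, Antwerp IV (1975), §1). [cite: IV1975] -/
def localTamagawaNumber_eq_one_of_hasGoodReduction : Prop :=
  ∀ [(W.minimal R).HasGoodReduction R],
    W.localTamagawaNumber R = 1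

/-- Model independence: the local Tamagawa number is invariant under admissible changes of
variables of the Weierstrass equation, since any two `R`-minimal equations of the same curve differ
by an `R`-integral change of variables commuting with reduction
(Silverman, *AEC*, Prop. VII.1.3(b) and VII.6, Ex. 7.6).

The hypothesis `[W.IsElliptic]` is necessary: when `Δ = 0` Mathlib's `IsMinimal` holds for every
integral model, so `W.minimal R` and `(C • W).minimal R` are arbitrary integral models of the same
singular cubic and the index may differ (module docstring). The name is the one fixed by the H21
outline (Mathlib style would be `localTamagawaNumber_smul`; compare
`hasMultiplicativeReductionAt_smul_iff` in `LocalReduction`, which carries `[W.IsElliptic]` for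
the same reason). [cite: SilvermanAEC2009, Prop. VII.1.3 (b) with §VII.6 (Ex. 7.6)] -/
def localTamagawaNumber_variableChange : Prop :=
  ∀ [W.IsElliptic] (C : VariableChange K),
    (C • W).localTamagawaNumber R = W.localTamagawaNumber R

end Local

section NumberField

open IsDedekindDomain NumberField

variable {K : Type*} [Field K] [NumberField K] (W : WeierstrassCurve K)

/-- The *Tamagawa product* `∏_v c_v` of a Weierstrass curve over a number field `K`, the product
over all finite places `v` of the local Tamagawa numbers `c_v = [E(K_v) : E₀(K_v)]` of
`W / K_v` (Wiles, Clay BSD text, §1; Silverman, *AEC*, Conj. C.16.5). It is a `finprod`, hence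
has junk value `1` if infinitely many factors differ from `1`; see
`mulSupport_localTamagawaNumber_finite`. Same indexing pattern as Mathlib's
`WeierstrassCurve.LFunction`. [folklore] -/
def tamagawaProduct : ℕ :=
  ∏ᶠ v : HeightOneSpectrum (𝓞 K),
    (W.baseChange (v.adicCompletion K)).localTamagawaNumber (v.adicCompletionIntegers K)

/-- Only the finitely many places of bad reduction contribute to the Tamagawa product: for an
elliptic curve over a number field, `c_v = 1` for all but finitely many finite places `v`
(Silverman, *AEC*, Prop. VII.5.1 (a): good reduction iff `v(Δ) = 0`, which fails for only
finitely many `v`; and §VII.2 after Prop. 2.1: `E₀(K) = E(K)` when `v(Δ) = 0`).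
[cite: SilvermanAEC2009, Prop. VII.5.1 (a) with §VII.2 (remark after Prop. 2.1)] -/
def mulSupport_localTamagawaNumber_finite : Prop :=
  ∀ [W.IsElliptic],
    (Function.mulSupport fun v : HeightOneSpectrum (𝓞 K) =>
      (W.baseChange (v.adicCompletion K)).localTamagawaNumber
        (v.adicCompletionIntegers K)).Finite

/-- Bridge to `Literature.Prelude.DiophValNum.LocalReduction`: the local Tamagawa factor of `W` at the
finite place `v` is the index `[E(K_v) : E₀(K_v)]` computed on the chosen local minimal model
`W.localMinimalModel v` (definitional; Silverman, *AEC*, VII.6, Ex. 7.6). [folklore] -/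
theorem localTamagawaNumber_baseChange_eq (v : HeightOneSpectrum (𝓞 K)) :
    (W.baseChange (v.adicCompletion K)).localTamagawaNumber (v.adicCompletionIntegers K) =
      ((W.localMinimalModel v).goodReductionSubgroup (v.adicCompletionIntegers K)).index :=
  rfl

/-- If `W` has good reduction at the finite place `v` (in the sense of
`WeierstrassCurve.HasGoodReductionAt` from `LocalReduction`) then its local Tamagawa factor at `v`
is `1` (Silverman, *AEC*, VII.2, remark after Prop. 2.1). This is
`localTamagawaNumber_eq_one_of_hasGoodReduction` with the `haveI` performed. [folklore] -/
def localTamagawaNumber_eq_one_of_hasGoodReductionAt : Prop :=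
  ∀ (v : HeightOneSpectrum (𝓞 K)) (h : W.HasGoodReductionAt v),
    (W.baseChange (v.adicCompletion K)).localTamagawaNumber (v.adicCompletionIntegers K) = 1

/- interim proof relied on results that are now named facts (D-0014); demoted to a fact by the M5 import, proof preserved:
:=
  haveI : ((W.baseChange (v.adicCompletion K)).minimal
      (v.adicCompletionIntegers K)).HasGoodReduction (v.adicCompletionIntegers K) := h
  localTamagawaNumber_eq_one_of_hasGoodReduction _ _
-/

/-- The Tamagawa product of an elliptic curve over a number field is a positive integer
(each `c_v` is a finite index; Silverman, *AEC*, Cor. VII.6.2; Wiles, Clay BSD text, §1).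
[cite: SilvermanAEC2009, Cor. VII.6.2] -/
def tamagawaProduct_pos : Prop :=
  ∀ [W.IsElliptic],
    0 < W.tamagawaProduct

end NumberField

section Rat

open IsDedekindDomain NumberField

/-- `W / ℚ` *has good reduction at the prime* `p`: the `ℤ_p`-minimal model of `W / ℚ_p` has
good reduction (Mathlib `WeierstrassCurve.HasGoodReduction`, `Padic`, `PadicInt.isFractionRing`);
model-independent (Silverman, *AEC*, VII.5, Prop. 5.1). Related to the place-indexed
`WeierstrassCurve.HasGoodReductionAt v`, `v : HeightOneSpectrum (𝓞 ℚ)`, by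
`hasGoodReductionAtPrime_primesEquiv_iff`. [folklore] -/
def HasGoodReductionAtPrime (W : WeierstrassCurve ℚ) (p : ℕ) [Fact p.Prime] : Prop :=
  ((W.baseChange ℚ_[p]).minimal ℤ_[p]).HasGoodReduction ℤ_[p]

/-- `W / ℚ` *has multiplicative reduction at the prime* `p`: the `ℤ_p`-minimal model of
`W / ℚ_p` has multiplicative reduction (Mathlib `WeierstrassCurve.HasMultiplicativeReduction`,
`Padic`, `PadicInt.isFractionRing`); model-independent for elliptic curves (Silverman, *AEC*,
VII.5, Prop. 5.1). Related to the place-indexed `WeierstrassCurve.HasMultiplicativeReductionAt v`,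
`v : HeightOneSpectrum (𝓞 ℚ)`, by `hasMultiplicativeReductionAtPrime_primesEquiv_iff`. [folklore] -/
def HasMultiplicativeReductionAtPrime (W : WeierstrassCurve ℚ) (p : ℕ) [Fact p.Prime] : Prop :=
  ((W.baseChange ℚ_[p]).minimal ℤ_[p]).HasMultiplicativeReduction ℤ_[p]

/-- Finiteness of `E(ℚ_p)/E₀(ℚ_p)`: the local Tamagawa number of an elliptic curve over `ℚ_p` is
nonzero (Silverman, *AEC*, Cor. VII.6.2; Tate, Antwerp IV (1975), §1). This is
`localTamagawaNumber_ne_zero` at `R = ℤ_[p]`, with the finiteness of the residue field supplied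
by Mathlib's `PadicInt.residueField : IsLocalRing.ResidueField ℤ_[p] ≃+* ZMod p`. [cite: IV1975] -/
def localTamagawaNumber_padic_ne_zero : Prop :=
  ∀ (p : ℕ) [Fact p.Prime] (W : WeierstrassCurve ℚ_[p]) [W.IsElliptic],
    W.localTamagawaNumber ℤ_[p] ≠ 0

/- interim proof relied on results that are now named facts (D-0014); demoted to a fact by the M5 import, proof preserved:
:=
  haveI : Finite (IsLocalRing.ResidueField ℤ_[p]) :=
    Finite.of_equiv (ZMod p) (PadicInt.residueField (p := p)).symm.toEquiv
  localTamagawaNumber_ne_zero ℤ_[p] W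
-/

/-- Bridge between the prime-indexed and the place-indexed good-reduction predicates over `ℚ`:
for a finite place `v` of `ℚ` corresponding to the rational prime `p = primesEquiv v` (Mathlib
`Rat.HeightOneSpectrum.primesEquiv`; the correspondence is a hypothesis `hv` because Mathlib
registers `Fact (primesEquiv v).1.Prime` only as a local instance), `W` has good reduction at `p`
iff it has good reduction at `v`. Proof route: transport minimal models and their reductions along the valued-field
isomorphism `Rat.HeightOneSpectrum.adicCompletion.padicEquiv v : v.adicCompletion ℚ ≃A[ℚ] ℚ_[p]`
restricting to `adicCompletionIntegers.padicIntEquiv v` (the criterion transported is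
Silverman, *AEC*, Prop. VII.5.1). A statement about two formalisations of the same notion
agreeing. [folklore] -/
def hasGoodReductionAtPrime_primesEquiv_iff : Prop :=
  ∀ (W : WeierstrassCurve ℚ) (v : HeightOneSpectrum (𝓞 ℚ)) (p : ℕ) [Fact p.Prime] (hv : (Rat.HeightOneSpectrum.primesEquiv v : ℕ) = p),
    W.HasGoodReductionAtPrime p ↔ W.HasGoodReductionAt v

/-- Bridge between the prime-indexed and the place-indexed multiplicative-reduction predicates
over `ℚ` (see `hasGoodReductionAtPrime_primesEquiv_iff`; Silverman, *AEC*, VII.5, Prop. 5.1).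
`[W.IsElliptic]` is needed because for `Δ = 0` the chosen minimal models on the two sides are
unrelated arbitrary integral models. Formalisation bridge, as the previous declaration.
[folklore] -/
def hasMultiplicativeReductionAtPrime_primesEquiv_iff : Prop :=
  ∀ (W : WeierstrassCurve ℚ) [W.IsElliptic] (v : HeightOneSpectrum (𝓞 ℚ)) (p : ℕ) [Fact p.Prime] (hv : (Rat.HeightOneSpectrum.primesEquiv v : ℕ) = p),
    W.HasMultiplicativeReductionAtPrime p ↔ W.HasMultiplicativeReductionAt v

/-- The local Tamagawa factor of `W / ℚ` at the finite place `v` (the factor of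
`tamagawaProduct`) equals the `p`-adic one, `p = primesEquiv v`, computed with Mathlib's `ℚ_[p]`
and `ℤ_[p]` (transport along `Rat.HeightOneSpectrum.adicCompletion.padicEquiv`; Silverman, *AEC*,
VII.6, Ex. 7.6). `[W.IsElliptic]` is needed for the same reason as in
`localTamagawaNumber_variableChange`. Formalisation bridge (transport of structure). [folklore] -/
def localTamagawaNumber_padic_eq : Prop :=
  ∀ (W : WeierstrassCurve ℚ) [W.IsElliptic] (v : HeightOneSpectrum (𝓞 ℚ)) (p : ℕ) [Fact p.Prime] (hv : (Rat.HeightOneSpectrum.primesEquiv v : ℕ) = p),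
    (W.baseChange ℚ_[p]).localTamagawaNumber ℤ_[p] =
      (W.baseChange (v.adicCompletion ℚ)).localTamagawaNumber (v.adicCompletionIntegers ℚ)

end Rat

end WeierstrassCurve

end
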